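import Literature.AlgebraicGeometry.HodgeTheory.WeilClassesDescendingAssembly
import Literature.AlgebraicGeometry.Motives.WeilFormRationalSignature
import Literature.NumberTheory.EllipticCurves.CMEndomorphismOfMulMemLattice
import HarnessLib

/-!
# `exists_weilTypeSurface_prod_isHyperbolicWeilType_all` from Hodge–Riemann in degree one and weighted Segre classes

Family `hodge`, layer `Literature/AlgebraicGeometry/HodgeTheory`. Last sibling of `WeilClassesDescending`
(the named fact `exists_weilTypeSurface_prod_isHyperbolicWeilType_all`: Markman, arXiv:2509.23403
§11.5 Step 2; van Geemen, LNM 1594, Lemma 5.2 (2)–(4), 5.3, 5.4 (5.4.1); Schoen 1998 §10) after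
`WeilClassesDescendingAssembly` (`exists_weilTypeSurface_prod_isHyperbolicWeilType_of_inputs`: the
fact's conclusion for a given `(A₁, φ₁)` from a CM curve, a signature-`(2n,2n)` degree-one model and
weighted embeddings). Here the CM curve is DISCHARGED — `ℂ/(ℤ + ℤ√-d)` with `[√-d]` is a complex
abelian variety `E₀` of dimension `1` with `ψ₀ ≫ ψ₀ = -(d • 𝟙)`
(`NumberTheory.EllipticCurves.CMEndomorphism.exists_cmCurve_sqrt_neg`, proved 2026-08-16) — and the
fact is PROVED FROM EXACTLY TWO classical statements, entered as hypotheses spelled out in the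
tree's vocabulary (no named fact is introduced, D-0026):

* **(HR₁) Hodge–Riemann in degree one for Weil-type abelian varieties, model form.** For a complex
  abelian `2n`-fold `(A, φ)`, `φ ≫ φ = -d`, carrying a non-zero rational `(n,n)`-class in its Weil
  plane (so `(A, ℚ(√-d))` has type `(n,n)`, van Geemen 5.2 (6)), and a hyperplane class
  `H = e^*a` (`e` a projective embedding, `a ≠ 0` rational): some rational degree-one model
  `(u, M, ω, G, d_A)` of `(A, φ, d·H + φ^*H)` (they exist: `Motives.exists_rationalModel_one`) has
  SIGNATURE `(2n, 2n)` — `M`-stable rational subspaces `P`, `N` of dimension `2n`, `P ∩ N = 0`, with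
  `x ↦ G(x, Mx)` positive on `P ∖ 0` and negative on `N ∖ 0`. In print: `E_h(x, φ^*y)` is the trace
  form of the `K`-Hermitian form `H` of 5.2 (2), whose signature is `(n, n)` by Hodge–Riemann
  `i E_h(α, ᾱ) > 0` on `H^{1,0}` (5.2 (4); Voisin I Thm. 6.32, `k = 1`) and `dim V₊ ∩ H^{1,0} = n`;
  a `K`-orthogonal basis makes `P`, `N` rational. (Either sign of `a` gives the same statement.)
* **(SEG) weighted Segre embeddings.** For complex abelian varieties `A` and `E₀` (`dim E₀ = 1`)
  there are a projective embedding `e` of `A` with a rational `a ≠ 0`, a rational `η ∈ H²(E₀(ℂ))`,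
  and for all `m₁, m₂ ≥ 1` a projective embedding `e'` of `A × (E₀ × E₀)` with a rational `a' ≠ 0`
  and `e'^* a' = pr_A^*(e^*a) + pr_B^*(m₁·pr₁^*η + m₂·pr₂^*η)` (Segre embedding of `e × (e₀ × e₀)`
  after re-embedding the factors `E₀` by `𝒪(m₁)`, `𝒪(m₂)`: `σ^*𝒪(1) = 𝒪(1) ⊠ 𝒪(1)`, Hartshorne II
  Ex. 5.11–5.12; `η = e₀^*[hyperplane]`).

`exists_weilTypeSurface_prod_isHyperbolicWeilType_all_of_hodgeRiemannOne_of_segre : (HR₁) → (SEG) → fact`,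
and `exists_weilTypeSurface_prod_isHyperbolicWeilType_all_of_realHodgeRiemannOne_of_segre`, the same
with (HR₁) in its REAL form (HR₁ℝ): the model carries real subspaces `W₊, W₋ ≤ ℝ^ι` of dimension
`2n` each on which the real extension of `x ↦ xᵀ G M x` is positive, resp. negative, definite (what
Hodge theory gives: `W₊ = Re((V₊ ∩ H^{1,0}) ⊕ (V₋ ∩ H^{0,1}))`); the rational `M`-stable subspaces are
then supplied by `Motives.exists_rational_signature_subspaces_of_real` (Gram–Schmidt over `ℚ(M)` and
Sylvester's count, file `Motives/WeilFormRationalSignature`).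
Neither (HR₁) nor (SEG) is in the tree yet (no orientation/trace pairing with positivity on the
carriers; no hyperplane-class calculus of Segre embeddings on `complexBetti`); each is a classical
theorem, NOT a restatement of the fact (the fact is about moduli of Weil type and Landherr's
classification; (HR₁) is Hodge theory of one variety, (SEG) projective geometry).

## References

* [vanGeemen1994HodgeAV] B. van Geemen, LNM 1594 (1994), Lemma 5.2 (2)–(6), 5.3, 5.4 (5.4.1).
* [Markman2025SurveySecant] E. Markman, arXiv:2509.23403, §11.5 Step 1–2.
* [Schoen1998HodgeWeilAddendum] C. Schoen, Compositio Math. 114 (1998), §10.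
* [VoisinHodgeI2002] C. Voisin, Hodge Theory and Complex Algebraic Geometry I (2002), Thm. 6.32.
* [Hartshorne1977] R. Hartshorne, Algebraic Geometry (1977), II Ex. 5.11–5.12.
* [SilvermanAEC2009] J. H. Silverman, The Arithmetic of Elliptic Curves (2009), VI Thm. 4.1 (b).
-/

noncomputable section

open CategoryTheory

namespace Literature.AlgebraicGeometry.HodgeTheory

open Literature.AlgebraicTopology.SingularHomology
open Literature.AlgebraicGeometry.Motives
open Literature.Geometry.Kaehler

/-- **The partner-surface fact from (HR₁) and (SEG).** See the module docstring for the two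
hypotheses; the CM curve is `CMEndomorphism.exists_cmCurve_sqrt_neg`, the partner surface, its
Weil classes and descent partner, the model of the CM curve, the aiming arithmetic and the frame
transport are `exists_weilTypeSurface_prod_isHyperbolicWeilType_of_inputs`.
[cite: Markman2025SurveySecant, §11.5 Step 2] [cite: vanGeemen1994HodgeAV, Lemma 5.2 (2)–(6), 5.3, 5.4 (5.4.1)]
[cite: Schoen1998HodgeWeilAddendum, §10] [cite: SilvermanAEC2009, VI Thm. 4.1 (b)] -/
theorem exists_weilTypeSurface_prod_isHyperbolicWeilType_all_of_hodgeRiemannOne_of_segre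
    (hHR : ∀ (n d j : ℕ) (A : Motives.AbelianVariety ℂ) (φ : A ⟶ A), 0 < n → 0 < d →
      A.dim = j + 1 → j + 1 = 2 * n → φ ≫ φ = -(d • 𝟙 A) →
      (∃ c : complexBetti A.X (2 * n), IsRationalClass c ∧
        IsOfHodgeType (2 * n) A.X (2 * n) n n c ∧ c ∈ weilClassesOf A φ n d ∧ c ≠ 0) →
      ∀ (e : Motives.ProjectiveEmbedding A.X) (a : complexBetti (Motives.projectiveSpace e.n ℂ) 2),
        IsRationalClass a → a ≠ 0 →
      ∃ (ι : Type) (_ : Fintype ι) (_ : DecidableEq ι) (u : ι → complexBetti A.X 1) (M : Matrix ι ι ℚ)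
        (ω : complexBetti A.X (2 + 2 * j)) (G : Matrix ι ι ℚ) (dA : ℚ),
        (∀ i, IsRationalClass (u i)) ∧ LinearIndependent ℂ u ∧ Submodule.span ℂ (Set.range u) = ⊤ ∧
        (∀ i, complexBetti.map φ.hom.hom.hom 1 (u i) = ∑ k, ((M k i : ℚ) : ℂ) • u k) ∧ ω ≠ 0 ∧
        (∀ i k, Motives.polarizationPairingOne A.X
          ((d : ℂ) • complexBetti.map e.ι 2 a + complexBetti.map φ.hom.hom.hom 2 (complexBetti.map e.ι 2 a))
          j (u i) (u k) = ((G i k : ℚ) : ℂ) • ω) ∧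
        lefschetzPow ((d : ℂ) • complexBetti.map e.ι 2 a + complexBetti.map φ.hom.hom.hom 2 (complexBetti.map e.ι 2 a))
          j 2 ((d : ℂ) • complexBetti.map e.ι 2 a + complexBetti.map φ.hom.hom.hom 2 (complexBetti.map e.ι 2 a)) =
          ((dA : ℚ) : ℂ) • ω ∧
        ∃ P N : Submodule ℚ (ι → ℚ), (∀ v ∈ P, M.mulVec v ∈ P) ∧ (∀ v ∈ N, M.mulVec v ∈ N) ∧
          Module.finrank ℚ P = 2 * n ∧ Module.finrank ℚ N = 2 * n ∧ P ⊓ N = ⊥ ∧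
          (∀ x ∈ P, x ≠ 0 → 0 < x ⬝ᵥ G.mulVec (M.mulVec x)) ∧
          (∀ x ∈ N, x ≠ 0 → x ⬝ᵥ G.mulVec (M.mulVec x) < 0))
    (hSeg : ∀ (A E₀ : Motives.AbelianVariety ℂ), E₀.dim = 1 →
      ∃ (e : Motives.ProjectiveEmbedding A.X) (a : complexBetti (Motives.projectiveSpace e.n ℂ) 2)
        (η : complexBetti E₀.X 2), IsRationalClass a ∧ a ≠ 0 ∧ IsRationalClass η ∧
        ∀ m₁ m₂ : ℕ, 0 < m₁ → 0 < m₂ →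
          ∃ (e' : Motives.ProjectiveEmbedding (A.prod (E₀.prod E₀)).X)
            (a' : complexBetti (Motives.projectiveSpace e'.n ℂ) 2), IsRationalClass a' ∧ a' ≠ 0 ∧
            complexBetti.map e'.ι 2 a' =
              complexBetti.map (AbelianVariety.fst A (E₀.prod E₀)).hom.hom.hom 2 (complexBetti.map e.ι 2 a) +
                complexBetti.map (AbelianVariety.snd A (E₀.prod E₀)).hom.hom.hom 2
                  ((m₁ : ℂ) • complexBetti.map (AbelianVariety.fst E₀ E₀).hom.hom.hom 2 η +
                    (m₂ : ℂ) • complexBetti.map (AbelianVariety.snd E₀ E₀).hom.hom.hom 2 η)) :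
    exists_weilTypeSurface_prod_isHyperbolicWeilType_all := by
  intro n hn d hd A₁ φ₁ hA₁ _hX hφ₁ hW
  obtain ⟨E₀, ψ₀, hE, hψ⟩ :=
    Literature.NumberTheory.EllipticCurves.CMEndomorphism.exists_cmCurve_sqrt_neg d hd
  obtain ⟨e, a, η, ha, ha0, hη, hfam⟩ := hSeg A₁ E₀ hE
  have hA : A₁.dim = (2 * n - 1) + 1 := by omega
  have hj : (2 * n - 1) + 1 = 2 * n := by omega
  obtain ⟨ι, _, _, u, M, ω, G, dA, hu, hui, hus, hM, hω0, hG, hdA, hPN⟩ :=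
    hHR n d (2 * n - 1) A₁ φ₁ hn hd hA hj hφ₁ hW e a ha ha0
  exact exists_weilTypeSurface_prod_isHyperbolicWeilType_of_inputs hd hA hj hφ₁ hE hψ η hη
    (complexBetti.map e.ι 2 a) u hu hui hus M hM ω hω0 G hG dA hdA hPN hfam

/-- **The partner-surface fact from (HR₁ℝ) — Hodge–Riemann in degree one in REAL form — and (SEG).**
As `exists_weilTypeSurface_prod_isHyperbolicWeilType_all_of_hodgeRiemannOne_of_segre`, but the
degree-one model of `(A, φ, d·e^*a + φ^*e^*a)` is only asked to carry REAL subspaces `W₊, W₋ ≤ ℝ^ι` of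
dimension `2n` each on which the real extension of `x ↦ xᵀ G M x` is positive, resp. negative,
definite; the rational `M`-stable signature subspaces are produced by
`Motives.exists_rational_signature_subspaces_of_real` from `M² = -d`
(`mulVec_mulVec_eq_neg_smul_of_comp_self`), the Weil type and the alternation of `G`
(`gram_map_eq_mul_gram`, `gram_antisymm`) and `|ι| = b₁(A) = 4n`.
[cite: vanGeemen1994HodgeAV, Lemma 5.2 (2)–(6), 5.3–5.4] [cite: Markman2025SurveySecant, §11.5 Step 2]
[cite: Schoen1998HodgeWeilAddendum, §10] [cite: SilvermanAEC2009, VI Thm. 4.1 (b)] -/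
theorem exists_weilTypeSurface_prod_isHyperbolicWeilType_all_of_realHodgeRiemannOne_of_segre
    (hHR : ∀ (n d j : ℕ) (A : Motives.AbelianVariety ℂ) (φ : A ⟶ A), 0 < n → 0 < d →
      A.dim = j + 1 → j + 1 = 2 * n → φ ≫ φ = -(d • 𝟙 A) →
      (∃ c : complexBetti A.X (2 * n), IsRationalClass c ∧
        IsOfHodgeType (2 * n) A.X (2 * n) n n c ∧ c ∈ weilClassesOf A φ n d ∧ c ≠ 0) →
      ∀ (e : Motives.ProjectiveEmbedding A.X) (a : complexBetti (Motives.projectiveSpace e.n ℂ) 2),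
        IsRationalClass a → a ≠ 0 →
      ∃ (ι : Type) (_ : Fintype ι) (_ : DecidableEq ι) (u : ι → complexBetti A.X 1) (M : Matrix ι ι ℚ)
        (ω : complexBetti A.X (2 + 2 * j)) (G : Matrix ι ι ℚ) (dA : ℚ),
        (∀ i, IsRationalClass (u i)) ∧ LinearIndependent ℂ u ∧ Submodule.span ℂ (Set.range u) = ⊤ ∧
        (∀ i, complexBetti.map φ.hom.hom.hom 1 (u i) = ∑ k, ((M k i : ℚ) : ℂ) • u k) ∧ ω ≠ 0 ∧
        (∀ i k, Motives.polarizationPairingOne A.X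
          ((d : ℂ) • complexBetti.map e.ι 2 a + complexBetti.map φ.hom.hom.hom 2 (complexBetti.map e.ι 2 a))
          j (u i) (u k) = ((G i k : ℚ) : ℂ) • ω) ∧
        lefschetzPow ((d : ℂ) • complexBetti.map e.ι 2 a + complexBetti.map φ.hom.hom.hom 2 (complexBetti.map e.ι 2 a))
          j 2 ((d : ℂ) • complexBetti.map e.ι 2 a + complexBetti.map φ.hom.hom.hom 2 (complexBetti.map e.ι 2 a)) =
          ((dA : ℚ) : ℂ) • ω ∧
        ∃ Wp Wm : Submodule ℝ (ι → ℝ), Module.finrank ℝ Wp = 2 * n ∧ Module.finrank ℝ Wm = 2 * n ∧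
          (∀ x ∈ Wp, x ≠ 0 →
            0 < x ⬝ᵥ (G.map (fun t : ℚ ↦ (t : ℝ))).mulVec ((M.map (fun t : ℚ ↦ (t : ℝ))).mulVec x)) ∧
          (∀ x ∈ Wm, x ≠ 0 →
            x ⬝ᵥ (G.map (fun t : ℚ ↦ (t : ℝ))).mulVec ((M.map (fun t : ℚ ↦ (t : ℝ))).mulVec x) < 0))
    (hSeg : ∀ (A E₀ : Motives.AbelianVariety ℂ), E₀.dim = 1 →
      ∃ (e : Motives.ProjectiveEmbedding A.X) (a : complexBetti (Motives.projectiveSpace e.n ℂ) 2)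
        (η : complexBetti E₀.X 2), IsRationalClass a ∧ a ≠ 0 ∧ IsRationalClass η ∧
        ∀ m₁ m₂ : ℕ, 0 < m₁ → 0 < m₂ →
          ∃ (e' : Motives.ProjectiveEmbedding (A.prod (E₀.prod E₀)).X)
            (a' : complexBetti (Motives.projectiveSpace e'.n ℂ) 2), IsRationalClass a' ∧ a' ≠ 0 ∧
            complexBetti.map e'.ι 2 a' =
              complexBetti.map (AbelianVariety.fst A (E₀.prod E₀)).hom.hom.hom 2 (complexBetti.map e.ι 2 a) +
                complexBetti.map (AbelianVariety.snd A (E₀.prod E₀)).hom.hom.hom 2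
                  ((m₁ : ℂ) • complexBetti.map (AbelianVariety.fst E₀ E₀).hom.hom.hom 2 η +
                    (m₂ : ℂ) • complexBetti.map (AbelianVariety.snd E₀ E₀).hom.hom.hom 2 η)) :
    exists_weilTypeSurface_prod_isHyperbolicWeilType_all := by
  intro n hn d hd A₁ φ₁ hA₁ _hX hφ₁ hW
  obtain ⟨E₀, ψ₀, hE, hψ⟩ :=
    Literature.NumberTheory.EllipticCurves.CMEndomorphism.exists_cmCurve_sqrt_neg d hd
  obtain ⟨e, a, η, ha, ha0, hη, hfam⟩ := hSeg A₁ E₀ hE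
  have hA : A₁.dim = (2 * n - 1) + 1 := by omega
  have hj : (2 * n - 1) + 1 = 2 * n := by omega
  obtain ⟨ι, _, _, u, M, ω, G, dA, hu, hui, hus, hM, hω0, hG, hdA, Wp, Wm, hWp, hWm, hpos, hneg⟩ :=
    hHR n d (2 * n - 1) A₁ φ₁ hn hd hA hj hφ₁ hW e a ha ha0
  -- the coordinate identities of the model of `(A₁, φ₁, h)`, `h = d·H + φ₁^*H`
  set H : complexBetti A₁.X 2 := complexBetti.map e.ι 2 a with hHdef
  set h : complexBetti A₁.X 2 := (d : ℂ) • H + complexBetti.map φ₁.hom.hom.hom 2 H with hh_def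
  have hMA : ∀ x, M.mulVec (M.mulVec x) = -((d : ℚ) • x) :=
    mulVec_mulVec_eq_neg_smul_of_comp_self hφ₁ hu hui M hM
  have hh : complexBetti.map φ₁.hom.hom.hom 2 h = (d : ℂ) • h := map_ksymm_eq_smul hφ₁ H
  have hgram := gram_map_eq_mul_gram hA (surface_finrank_complexBetti_one A₁)
    ((surface_hasExteriorCohomologyH1 A₁).span_range_cupPowOne (2 + 2 * (2 * n - 1))) hd hφ₁ hh u M hM
    hω0 G hG
  have hWA : ∀ x y : ι → ℚ, M.mulVec x ⬝ᵥ G.mulVec (M.mulVec y) = (d : ℚ) * (x ⬝ᵥ G.mulVec y) :=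
    dotProduct_mulVec_mulVec_of_gram M G d hgram
  have hGt : ∀ x y : ι → ℚ, y ⬝ᵥ G.mulVec x = -(x ⬝ᵥ G.mulVec y) :=
    dotProduct_mulVec_antisymm G (gram_antisymm h (2 * n - 1) u hω0 G hG)
  have hcard : Fintype.card ι = 4 * n := by rw [card_eq_of_frame hui hus, hA]; omega
  have hdq : (0 : ℚ) < d := by exact_mod_cast hd
  obtain ⟨P, N, hPM, hNM, hP, hN, hPN, hPpos, hNneg⟩ :=
    Motives.exists_rational_signature_subspaces_of_real hdq hMA hGt hWA n hcard Wp Wm hWp hWm hpos hneg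
  exact exists_weilTypeSurface_prod_isHyperbolicWeilType_of_inputs hd hA hj hφ₁ hE hψ η hη H u hu hui hus
    M hM ω hω0 G hG dA hdA ⟨P, N, hPM, hNM, hP, hN, hPN, hPpos, hNneg⟩ hfam

end Literature.AlgebraicGeometry.HodgeTheory

end
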